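import Summits.AtomisticToContinuum.HydrodynamicLimit.Theorems.VitaliAmplitudeTransferAmplitudeTransferAnalysis

/-!
# Amplitude transfer — the transfer for one observable (steps (3)–(4), pure analysis)

The real-analysis skeleton of the Vitali amplitude transfer (route `VitaliAmplitudeTransfer`, item
`AmplitudeTransfer`) for a single scalar observable: a sequence of functions `m N` on `[0,1]`
(the local Gibbs means along the path) and a limit function `e` (the tested Euler field along the
family) such that

* on every sub-path `δ ↦ δ₂δ`, `δ₂ < 1`, the `m N` are restrictions of holomorphic functions
  bounded by one constant on one complex neighbourhood of `[0,1]` (`UniformAmplitudeAnalyticity`),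
* on every sub-path, `m N (δ₂δ) → e (δ₂δ)` for all small `δ` (`NearEquilibriumLimit` with
  `FieldVarianceBound`),
* `e` is real-analytic on `[0,1)` and continuous at `1` within `[0,1]` (`AnalyticPreShockPaths`),
* the `m N` are equi-Lipschitz at `1` (`FieldVarianceBound`, step (4)),

converge at the endpoint: `m N 1 → e 1` (`tendsto_one_of_subpaths`).
-/

open Filter Set Topology Metric

namespace Summit.AtomisticToContinuum.HydrodynamicLimit.Theorems.AmplitudeTransfer

/-- **Convergence below the endpoint** from the sub-path data: `m N δ → e δ` for every
`δ ∈ [0,1)`. -/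
theorem tendsto_of_subpaths {m : ℕ → ℝ → ℝ} {e : ℝ → ℝ}
    (hA : ∀ δ₂ ∈ Ioo (0 : ℝ) 1, ∃ r : ℝ, 0 < r ∧ ∃ M : ℝ, ∀ N, ∃ g : ℂ → ℂ,
      DifferentiableOn ℂ g (thickening r (Complex.ofReal '' Icc (0 : ℝ) 1)) ∧
      (∀ ζ ∈ thickening r (Complex.ofReal '' Icc (0 : ℝ) 1), ‖g ζ‖ ≤ M) ∧
      ∀ δ ∈ Icc (0 : ℝ) 1, g (δ : ℂ) = ((m N (δ₂ * δ) : ℝ) : ℂ))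
    (hB : ∀ δ₂ ∈ Ioo (0 : ℝ) 1, ∃ δ₁ : ℝ, 0 < δ₁ ∧ ∀ δ ∈ Ioo (0 : ℝ) δ₁, δ ≤ 1 →
      Tendsto (fun N => m N (δ₂ * δ)) atTop (𝓝 (e (δ₂ * δ))))
    (he : AnalyticOnNhd ℝ e (Ico (0 : ℝ) 1)) :
    ∀ δ ∈ Ico (0 : ℝ) 1, Tendsto (fun N => m N δ) atTop (𝓝 (e δ)) := by
  intro δ hδ
  -- the sub-path through `δ`
  set δ₂ : ℝ := (1 + δ) / 2 with hδ₂
  have hδ₂I : δ₂ ∈ Ioo (0 : ℝ) 1 := ⟨by rw [hδ₂]; linarith [hδ.1], by rw [hδ₂]; linarith [hδ.2]⟩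
  have hδ₂0 : 0 < δ₂ := hδ₂I.1
  set x : ℝ := δ / δ₂ with hx
  have hxI : x ∈ Icc (0 : ℝ) 1 := by
    refine ⟨div_nonneg hδ.1 hδ₂0.le, ?_⟩
    rw [hx, div_le_one hδ₂0, hδ₂]
    linarith [hδ.2]
  have hxδ : δ₂ * x = δ := by rw [hx]; field_simp
  obtain ⟨r, hr, M, hg⟩ := hA δ₂ hδ₂I
  obtain ⟨δ₁, hδ₁, hconv⟩ := hB δ₂ hδ₂I
  -- the Vitali step on the sub-path
  have he' : AnalyticOnNhd ℝ (fun y : ℝ => e (δ₂ * y)) (Icc (0 : ℝ) 1) := by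
    intro y hy
    have hmem : δ₂ * y ∈ Ico (0 : ℝ) 1 :=
      ⟨mul_nonneg hδ₂0.le hy.1, by nlinarith [hy.2, hδ₂I.2]⟩
    exact (he _ hmem).comp (analyticAt_const.mul analyticAt_id)
  have hV := tendsto_of_vitali (m := fun N y => m N (δ₂ * y)) (e := fun y => e (δ₂ * y)) hr hg
    (lt_min hδ₁ one_pos) (min_le_right _ _)
    (fun y hy => hconv y ⟨hy.1, lt_of_lt_of_le hy.2 (min_le_left _ _)⟩
      (hy.2.le.trans (min_le_right _ _))) he' x hxI
  simpa only [hxδ] using hV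

/-- **The transfer for one observable.** Sub-path analyticity with uniform bounds, sub-path
convergence for small amplitudes, analyticity of the limit on `[0,1)` with continuity at `1`, and
equi-Lipschitz means at `1` give convergence at the endpoint: `m N 1 → e 1`. -/
theorem tendsto_one_of_subpaths {m : ℕ → ℝ → ℝ} {e : ℝ → ℝ} {L : ℝ}
    (hA : ∀ δ₂ ∈ Ioo (0 : ℝ) 1, ∃ r : ℝ, 0 < r ∧ ∃ M : ℝ, ∀ N, ∃ g : ℂ → ℂ,
      DifferentiableOn ℂ g (thickening r (Complex.ofReal '' Icc (0 : ℝ) 1)) ∧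
      (∀ ζ ∈ thickening r (Complex.ofReal '' Icc (0 : ℝ) 1), ‖g ζ‖ ≤ M) ∧
      ∀ δ ∈ Icc (0 : ℝ) 1, g (δ : ℂ) = ((m N (δ₂ * δ) : ℝ) : ℂ))
    (hB : ∀ δ₂ ∈ Ioo (0 : ℝ) 1, ∃ δ₁ : ℝ, 0 < δ₁ ∧ ∀ δ ∈ Ioo (0 : ℝ) δ₁, δ ≤ 1 →
      Tendsto (fun N => m N (δ₂ * δ)) atTop (𝓝 (e (δ₂ * δ))))
    (he : AnalyticOnNhd ℝ e (Ico (0 : ℝ) 1)) (he1 : ContinuousWithinAt e (Icc (0 : ℝ) 1) 1)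
    (hlip : ∀ N, ∀ δ ∈ Icc (0 : ℝ) 1, |m N 1 - m N δ| ≤ L * (1 - δ)) :
    Tendsto (fun N => m N 1) atTop (𝓝 (e 1)) :=
  tendsto_endpoint (tendsto_of_subpaths hA hB he) he1 hlip

end Summit.AtomisticToContinuum.HydrodynamicLimit.Theorems.AmplitudeTransfer
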